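import Literature.NumberTheory.LFunctions.SubnormalZetaGapsKappa
import HarnessLib

/-!
LANDING NOTE (typer ls-idea-typ-1 gen 1, cell ls-idea): authored by seat ls-idea-lens-6 gen 2 (sketch #5
`Sketch_MixedPairs.lean` sha16 4076391528777ea7, `lean check` rc 0; card K6-9 «MIXED PAIRS»; critics
A PASS = LEAST CI-GAPS REQUIREMENT OF RECORD (class-group reading at `ψ = 1`, mixed supply) + located
barrier BN-mix (batch 15) · C PASS-ledger/barrier (batch 19) · B batch 15). Landed VERBATIM (one cite
tag added): the `q`-uniform Dedekind hypothesis `H_K(A, α)` on the tree's `ConreyIwaniec2002` objects,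
the budget arithmetic PROVED modulo the named fact `conreyIwaniec2002_theorem11`, and the two product
lemmas showing that ζ-only pairs (K6-5's `SubnormalGapsHypothesisKappa`) and MIXED (ζ, L(χ_q)) pairs
both feed the count. Nothing about actual zeros is asserted. «The programme SEARCHES and TYPES; no claim
about Landau–Siegel zeros, Theorems 1–2 of arXiv:2211.02515 or a repaired Margin232 until a kernel
theorem says so.»

# The CI-GAPS door read at `ψ = 1` with BOTH factors of `ζ_K = ζ·L(s,χ)` — the least Conrey–Iwaniec
# requirement counts (ζ-zero, L(χ_q)-zero) pairs (card K6-9 «MIXED PAIRS», seat ls-idea-lens-6)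

Conrey–Iwaniec 2002, Thm 1.1 [held: paper:arxiv-math_0111012 p0002:L104–L116] is typed in the tree as
`conreyIwaniec2002_theorem11` for EVERY class group character `ψ : ClassGroup (𝓞 K) →* ℂˣ` of
`K = ℚ(√−q)`, with the count `ConreyIwaniec2002.closeZeroCount (classGroupLFunction K ψ) α T` generic in
the function. At `ψ = 1`, `classGroupLFunction K 1 = ζ_K = ζ(s)·L(s,χ_q)` off `s = 1`
(`classGroupLFunction_one`; CI p0003:L1–L6: «An interesting case is ζ_K(s) = ζ(s)L(s,χ) … Since we do
not need all the zeros we choose only these of ζ(s)» — print DISCARDS the `χ`-zeros to obtain the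
absolute Thm 1.2). Card K6-5 (gen 1) read the door with ζ-zeros only (`SubnormalGapsHypothesisKappa`).
K6-9: the printed hypothesis at `ψ = 1` is satisfied by MIXED close pairs — a critical zero of `ζ` and a
critical zero of `L(s,χ_q)` within `π(1−α)/log γ` of each other (and by `χχ` pairs) — so the LEAST
requirement of the door is the `q`-uniform statement `H_K(A, α)` below, in which no single `L`-function
needs a sub-half gap. This file types `H_K(A, α)` on the tree's objects and proves the budget arithmetic
`H_K(A, α) ∧ Thm 1.1 ⇒ L(1,χ) ≥ ¼ (log q)^{−(4A+18)}` for odd quadratic `χ` (Theorem-1 budget: `4A+18 <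
2022 ⇔ A < 501`, density exponent `κ = A/(A+6) < 501/507` as in `ciGaps_budget_iff`).

## References
* [ConreyIwaniec2002] J. B. Conrey, H. Iwaniec, Acta Arith. 103 (2002) 259–312 = arXiv:math/0111012,
  §1 (1.19)–(1.21), Thm 1.1; p. 3 L1–L6 (the `ζ_K` remark). [held: paper:arxiv-math_0111012]
* Y. Motohashi, Math. Ann. 188 (1970) 123–127 (the mixed second moment `∫|ζ L(χ)|² ∼ (6/π²)L(1,χ)² c_q
  T log² T`, quoted from W. Heap, arXiv:1303.6119, (2)) — context for the barrier note BN-mix, not cited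
  by any declaration.
-/

noncomputable section

open scoped NumberField
open Complex

namespace Literature.NumberTheory.LFunctions

open ConreyIwaniec2002 NumberField

/-- **`H_K(A, α)` — the mixed-pairs (Dedekind) CI-GAPS requirement** (card K6-9): for every `c > 0`
and all large odd fundamental `−q`, at SOME height `T` with `(log q)^{A+6} ≤ log T ≤ 2(log q)^{A+6}` the
count `D(α,T)` of (1.19) for `ζ_K = L(s, ψ = 1)` — critical zeros of `ζ(s)L(s,χ_q)` (of EITHER factor)
whose nearest critical zero of `ζ_K` (of EITHER factor) lies within `π(1−α)/log γ` — is at least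
`c T log T/(α (log q)^A)`, i.e. a proportion `≍ (log T)^{−A/(A+6)}/α` of the `∼ (T/π) log T` critical-line
zeros of `ζ_K`. The `q`-uniformity of the height window is the content (for fixed `q` and `T → ∞`
Thm 1.1 constrains nothing). A PREDICATE; never asserted. [cite: ConreyIwaniec2002, Theorem 1.1 (1.19)–(1.20); p. 3 L1–L6] -/
def DedekindCloseZeroHypothesis (A α : ℝ) : Prop :=
  ∀ c : ℝ, 0 < c → ∃ q₀ : ℕ, ∀ (q : ℕ) [NeZero q], q₀ ≤ q → 4 < q →
    ∀ χ : DirichletCharacter ℂ q, χ.IsPrimitive → χ.IsQuadratic → χ.Odd →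
      ∀ (K : Type) [Field K] [NumberField K],
        Module.finrank ℚ K = 2 → NumberField.discr K = -(q : ℤ) →
          ∃ T : ℝ, 2 ≤ T ∧ Real.log q ^ (A + 6) ≤ Real.log T ∧
            Real.log T ≤ 2 * Real.log q ^ (A + 6) ∧
              c * T * Real.log T / (α * Real.log q ^ A) ≤
                (closeZeroCount (classGroupLFunction K 1) α T : ℝ)

/-- **The door at `ψ = 1` (budget arithmetic, proved modulo the named fact Thm 1.1):**
`H_K(A, α)` and Conrey–Iwaniec's Theorem 1.1 give `L(1,χ) ≥ ¼ (log q)^{−(4A+18)}` for all large odd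
quadratic `χ` — inside the Theorem-1 currency `(log D)^{−A′}`, `A′ < 2022`, exactly when `A < 501`.
[cite: ConreyIwaniec2002, Theorem 1.1 (1.21)] -/
theorem lOne_lowerBound_of_dedekindCloseZero {A α : ℝ} (hA : 0 ≤ A) (hα : 0 < α) (hα1 : α ≤ 1)
    (hCI : conreyIwaniec2002_theorem11) (h : DedekindCloseZeroHypothesis A α) :
    ∃ q₀ : ℕ, ∀ (q : ℕ) [NeZero q], q₀ ≤ q → 4 < q →
      ∀ χ : DirichletCharacter ℂ q, χ.IsPrimitive → χ.IsQuadratic → χ.Odd →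
        ∀ (K : Type) [Field K] [NumberField K],
          Module.finrank ℚ K = 2 → NumberField.discr K = -(q : ℤ) →
            (1 / 4) * Real.log q ^ (-(4 * A + 18)) ≤ ‖χ.LFunction 1‖ := by
  obtain ⟨c, hc, hci⟩ := hCI
  obtain ⟨q₀, hq₀⟩ := h c hc
  refine ⟨q₀, fun q _ hq hq4 χ hprim hquad hodd K _ _ h2 hdisc => ?_⟩
  obtain ⟨T, hT2, hlo, hhi, hcount⟩ := hq₀ q hq hq4 χ hprim hquad hodd K h2 hdisc
  have hq1 : (1 : ℝ) < q := by exact_mod_cast (show 1 < q by omega)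
  have hlq : 0 < Real.log q := Real.log_pos hq1
  have hpowpos : 0 < Real.log q ^ (A + 6) := Real.rpow_pos_of_pos hlq _
  have hlT : 0 < Real.log T := lt_of_lt_of_le hpowpos hlo
  -- Theorem 1.1 at `ψ = 1`
  have key := hci A hA q hq4 χ hprim hquad hodd K h2 hdisc 1 T α hT2 hα hα1 hlo hcount
  -- `(log T)^{-2} ≥ (2 (log q)^{A+6})^{-2} = ¼ (log q)^{-(2A+12)}`
  have h1 : (1 / 4) * Real.log q ^ (-(2 * A + 12)) ≤ Real.log T ^ (-(2 : ℝ)) := by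
    have e1 : Real.log T ^ (-(2 : ℝ)) = (Real.log T ^ (2 : ℝ))⁻¹ := Real.rpow_neg hlT.le 2
    have e2 : Real.log q ^ (-(2 * A + 12)) = (Real.log q ^ (2 * A + 12))⁻¹ :=
      Real.rpow_neg hlq.le _
    rw [e1, e2]
    have hsq : Real.log T ^ (2 : ℝ) ≤ 4 * Real.log q ^ (2 * A + 12) := by
      have hle : Real.log T ^ (2 : ℝ) ≤ (2 * Real.log q ^ (A + 6)) ^ (2 : ℝ) :=
        Real.rpow_le_rpow hlT.le hhi (by norm_num)
      have heq : (2 * Real.log q ^ (A + 6)) ^ (2 : ℝ) = 4 * Real.log q ^ (2 * A + 12) := by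
        rw [Real.mul_rpow (by norm_num) hpowpos.le, ← Real.rpow_mul hlq.le]
        have : (A + 6) * 2 = 2 * A + 12 := by ring
        rw [this]; norm_num
      rw [heq] at hle; exact hle
    have hpos2 : 0 < Real.log T ^ (2 : ℝ) := Real.rpow_pos_of_pos hlT _
    have hpos4 : 0 < 4 * Real.log q ^ (2 * A + 12) := by positivity
    calc (1 / 4) * (Real.log q ^ (2 * A + 12))⁻¹ = (4 * Real.log q ^ (2 * A + 12))⁻¹ := by
          rw [mul_inv]; norm_num
      _ ≤ (Real.log T ^ (2 : ℝ))⁻¹ := by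
          exact inv_anti₀ hpos2 hsq
  -- assemble: `¼ (log q)^{-(4A+18)} = ¼ (log q)^{-(2A+12)} · (log q)^{-(2A+6)} ≤ (log T)^{-2} (log q)^{-(2A+6)}`
  have hsplit : Real.log q ^ (-(4 * A + 18)) =
      Real.log q ^ (-(2 * A + 12)) * Real.log q ^ (-(2 * A + 6)) := by
    rw [← Real.rpow_add hlq]; congr 1; ring
  have hpos6 : 0 ≤ Real.log q ^ (-(2 * A + 6)) := (Real.rpow_pos_of_pos hlq _).le
  calc (1 / 4) * Real.log q ^ (-(4 * A + 18))
        = ((1 / 4) * Real.log q ^ (-(2 * A + 12))) * Real.log q ^ (-(2 * A + 6)) := by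
          rw [hsplit]; ring
    _ ≤ Real.log T ^ (-(2 : ℝ)) * Real.log q ^ (-(2 * A + 6)) :=
          mul_le_mul_of_nonneg_right h1 hpos6
    _ ≤ ‖χ.LFunction 1‖ := key

/-- The Theorem-1 budget read on `H_K`: the effective exponent `4A + 18` is `< 2022` iff `A < 501`
(density exponent `κ = A/(A+6) < 501/507`, cf. `ciGaps_budget_iff`). [cite: ConreyIwaniec2002, Theorem 1.1 (1.21)] -/
theorem dedekind_budget_iff (A : ℝ) : 4 * A + 18 < 2022 ↔ A < 501 := by
  constructor <;> intro h <;> linarith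

/-- `ζ`-only is a special case: every ordinate counted by `SubnormalGapsHypothesisKappa`'s set for a
function `L₁` is counted for the product `L₁ · L₂` (a zero of `L₁` is a zero of `L₁L₂`, a close
`L₁`-neighbour is a close `L₁L₂`-neighbour, and a multiple zero of `L₁` is a multiple zero of `L₁L₂`),
provided `L₂` is differentiable there. This is the monotonicity «`H(κ,α)` for `ζ` ⇒ the `ζ_K` count is at
least as large» behind K6-5, now visibly WASTEFUL: the product also counts mixed and `L₂L₂` pairs.
[cite: ConreyIwaniec2002, §1 (1.19); p. 3 L1–L6] -/
theorem hasCloseZero_mul {L₁ L₂ : ℂ → ℂ} {r γ : ℝ}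
    (hd₁ : DifferentiableAt ℂ L₁ (1 / 2 + γ * I)) (hd₂ : DifferentiableAt ℂ L₂ (1 / 2 + γ * I))
    (h : HasCloseZero L₁ r γ) : HasCloseZero (fun s => L₁ s * L₂ s) r γ := by
  obtain ⟨hz, hrest⟩ := h
  refine ⟨by simp only [hz, zero_mul], ?_⟩
  rcases hrest with hder | ⟨γ', hne, hz', hdist⟩
  · left
    have : deriv (fun s => L₁ s * L₂ s) (1 / 2 + γ * I) =
        deriv L₁ (1 / 2 + γ * I) * L₂ (1 / 2 + γ * I) + L₁ (1 / 2 + γ * I) * deriv L₂ (1 / 2 + γ * I) :=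
      deriv_mul hd₁ hd₂
    rw [this, hder, hz]; simp
  · right
    exact ⟨γ', hne, by simp only [hz', zero_mul], hdist⟩

/-- … and the genuinely new supply: a MIXED pair — `L₁(½+iγ) = 0`, `L₂(½+iγ′) = 0`, `γ′ ≠ γ`,
`|γ − γ′| ≤ r` — is counted for the product although neither factor need have a close pair of its own.
[cite: ConreyIwaniec2002, §1 (1.19); p. 3 L1–L6] -/
theorem hasCloseZero_mul_of_mixed {L₁ L₂ : ℂ → ℂ} {r γ γ' : ℝ}
    (hz : L₁ (1 / 2 + γ * I) = 0) (hz' : L₂ (1 / 2 + γ' * I) = 0) (hne : γ' ≠ γ)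
    (hdist : |γ - γ'| ≤ r) : HasCloseZero (fun s => L₁ s * L₂ s) r γ :=
  ⟨by simp only [hz, zero_mul], Or.inr ⟨γ', hne, by simp only [hz', mul_zero], hdist⟩⟩

end Literature.NumberTheory.LFunctions
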